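import Mathlib.Analysis.Calculus.InverseFunctionTheorem.FDeriv
import Mathlib.Analysis.Calculus.InverseFunctionTheorem.ContDiff
import Mathlib.Analysis.SpecialFunctions.Complex.LogDeriv
import Mathlib.Analysis.SpecialFunctions.Trigonometric.Bounds
import Mathlib.Analysis.InnerProductSpace.Calculus
import Mathlib.Analysis.Complex.RealDeriv
import Mathlib.Analysis.Real.Pi.Bounds
import Mathlib.Topology.Order.Rolle
import Mathlib.Topology.Maps.Proper.CompactlyGenerated
import Mathlib.Analysis.Normed.Group.CocompactMap
import Literature.Topology.PlaneTopology.MonotoneLiftSmoothing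
import Literature.Topology.PlaneTopology.Schoenflies
import HarnessLib

/-!
# Extending a circle homeomorphism to the plane, smoothly inside the disc (the Alexander trick
# with smooth interior)

Topic `Literature/Topology/PlaneTopology`. **Everything in this file is proved; no named fact is
introduced.**

Main result (namespace `Literature.Topology.PlaneTopology.SmoothExtension`, restated at topic
level as `exists_homeomorph_sphere_extension_contDiffOn_ball`):

* `exists_homeomorph_extension_contDiffOn` — every homeomorphism of the unit circle (a continuous
  bijection `f` of `sphere (0 : ℂ) 1` onto itself) extends to a homeomorphism `F : ℂ ≃ₜ ℂ` with
  `F = f` on the circle, `‖F z‖ = ‖z‖` (so `F` maps the closed disc, the open disc and the circle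
  onto themselves: `Schoenflies.image_ball_eq_of_norm_eq`, `Schoenflies.image_closedBall_eq_of_norm_eq`,
  `Schoenflies.image_sphere_eq_of_norm_eq` of `Schoenflies.lean`), and such that **`F`
  restricted to the open unit disc is a `C^∞` diffeomorphism onto the open unit disc**
  (`ContDiffOn ℝ ∞ F (ball 0 1)` and `ContDiffOn ℝ ∞ F.symm (ball 0 1)`).

The continuous cone `r ζ ↦ r f(ζ)` (`Schoenflies.radialExtend`, Pommerenke (1992), proof of
Cor. 2.9, formula (4); Bing (1983), proof of Thm. III.6.B) is a homeomorphism but is not smooth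
at the centre nor along the radii when `f` is not smooth, and the topological annulus twist of
the sibling file `CircleHomeomorphExtension.lean` (`CircleTwist`, identity on an inner disc) is
likewise only continuous; the smooth-interior refinement is
folklore (published instances: the harmonic extension is a diffeomorphism of the open disc —
the Radó–Kneser–Choquet theorem; the conformally natural extension of Douady–Earle (1986)). It is
the tool that lets two smooth structures be glued along a topologically embedded circle: used with
the Schoenflies theorem of the tree (`Schoenflies.lean`) in the "smooth-domain seam" construction
of smooth structures on topological surfaces (the `n = 2` leaf of
`Literature.Topology.FourManifolds.exists_chartedSpace_isManifold_of_le_three`, seat 1 /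
approach B).

## Construction

1. `exists_lift_of_bijOn_sphere`: lift `f` along `θ ↦ e^{iθ}` (continuous logarithm on `ℝ`,
   `hasLogOn_univ`) to a continuous `φ` with `f (e^{iθ}) = e^{iφ θ}`; injectivity of `f` makes
   `φ` injective (an interior extremum on a segment with equal end values would give two points
   at distance `< 2π` with equal values, `injective_of_apply_eq_imp_exp_eq`), hence strictly
   monotone, and of degree `±1` (`φ (θ + 2π) = φ θ ± 2π`; degree `|d| ≥ 2` would again produce
   such a pair). A decreasing lift is reduced to an increasing one by complex conjugation.
2. Inside the disc `F` is the **twist** `r e^{iθ} ↦ r e^{i Λ_r θ}` (`twist`) by the smoothed lifts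
   `Λ_r = LiftSmoothing.family φ r` of `MonotoneLiftSmoothing.lean` (a rotation for `r ≤ 1/2`,
   smooth jointly, strictly increasing and `2π`-equivariant, `Λ_r → φ` uniformly as `r → 1⁻`);
   it is smooth on the open disc (read through the branches `arg` and `arg (-·) + π` of the
   argument, `contDiffOn_twist_ball`), bijective (`bijOn_twist_ball`), and continuous up to the
   circle where it becomes `f`.
3. The inverse lifts `M_r = Λ_r⁻¹` are smooth jointly (`contDiffOn_invFamily`): the shear
   `(r, θ) ↦ (r, Λ_r θ)` is injective with invertible (triangular) derivative, and an injective
   smooth map with invertible derivative has a smooth inverse on its open image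
   (`isOpen_image_and_contDiffOn_invFunOn`, inverse function theorem point by point); the twist by
   `M` inverts the twist by `Λ`, which gives smoothness of `F.symm` on the disc.
4. Outside the disc `F` is the radial extension; the glued map is continuous, bijective and
   proper, hence a homeomorphism (`isHomeomorph_iff_continuous_isClosedMap_bijective`).

## References

* Ch. Pommerenke, *Boundary Behaviour of Conformal Maps* (1992), §2.3, proof of Cor. 2.9,
  formula (4) (the continuous radial extension). [PommerenkeBBCM1992]
* R. H. Bing, *The Geometric Topology of 3-Manifolds* (1983), §III.6, proof of Thm. III.6.B.
  [Bing1983]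
* A. Douady, C. J. Earle, *Conformally natural extension of homeomorphisms of the circle*, Acta
  Math. 157 (1986) 23–48.
* A. Hatcher, *The Kirby torus trick for surfaces*, arXiv:1312.3518 (2013), "Smoothing
  0-handles" (context: isotopies of the disc in smoothing theory of surfaces).
-/

noncomputable section

open Set Filter MeasureTheory Function Metric
open scoped ContDiff Topology

namespace Literature.Topology.PlaneTopology

namespace SmoothExtension

/-! ## Part II — smooth inverses, the polar twist -/

section InverseSmooth

variable {E F : Type*} [NormedAddCommGroup E] [NormedSpace ℝ E] [CompleteSpace E]
  [NormedAddCommGroup F] [NormedSpace ℝ F]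

/-- **A smooth injective map with invertible derivative has an open image and a smooth inverse**
(inverse function theorem at each point: the local inverses agree with the global one by
injectivity). [folklore] -/
theorem isOpen_image_and_contDiffOn_invFunOn [Nonempty E] {f : E → F} {O : Set E} (hO : IsOpen O)
    (hinj : InjOn f O) {n : WithTop ℕ∞} {L : E → E ≃L[ℝ] F}
    (hder : ∀ p ∈ O, HasStrictFDerivAt f (L p : E →L[ℝ] F) p) (hf : ∀ p ∈ O, ContDiffAt ℝ n f p) :
    IsOpen (f '' O) ∧ ContDiffOn ℝ n (invFunOn f O) (f '' O) := by
  set G := invFunOn f O with hG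
  have hGleft : ∀ p ∈ O, G (f p) = p := fun p hp => hinj.leftInvOn_invFunOn hp
  have key : ∀ p ∈ O, ∃ S : Set F, IsOpen S ∧ f p ∈ S ∧ S ⊆ f '' O ∧ ContDiffOn ℝ n G S := by
    intro p hp
    set e := HasStrictFDerivAt.toOpenPartialHomeomorph f (hder p hp) with he
    have hecoe : (e : E → F) = f := HasStrictFDerivAt.toOpenPartialHomeomorph_coe (hder p hp)
    have hps : p ∈ e.source := HasStrictFDerivAt.mem_toOpenPartialHomeomorph_source (hder p hp)
    set S : Set F := e '' (e.source ∩ O) with hS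
    have hSo : IsOpen S := e.isOpen_image_of_subset_source (e.open_source.inter hO) inter_subset_left
    have hpS : f p ∈ S := ⟨p, ⟨hps, hp⟩, by rw [hecoe]⟩
    have hSsub : S ⊆ f '' O := by
      rintro _ ⟨q, ⟨-, hq⟩, rfl⟩
      exact ⟨q, hq, by rw [hecoe]⟩
    refine ⟨S, hSo, hpS, hSsub, ?_⟩
    have hGe : ∀ y ∈ S, G y = e.symm y := by
      rintro _ ⟨q, ⟨hqs, hqO⟩, rfl⟩
      rw [hecoe, hGleft q hqO]
      have := e.left_inv hqs
      rw [hecoe] at this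
      exact this.symm
    intro y hy
    have hy' : y ∈ e.target := by
      obtain ⟨q, ⟨hqs, -⟩, rfl⟩ := hy
      exact e.map_source hqs
    have hsymm : ContDiffAt ℝ n e.symm y := by
      have hqO : e.symm y ∈ O := by
        obtain ⟨q, ⟨hqs, hqO⟩, rfl⟩ := hy
        rwa [e.left_inv hqs]
      refine e.contDiffAt_symm hy' (f₀' := L (e.symm y)) ?_ ?_
      · rw [hecoe]; exact (hder _ hqO).hasFDerivAt
      · rw [hecoe]; exact hf _ hqO
    refine (hsymm.congr_of_eventuallyEq ?_).contDiffWithinAt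
    filter_upwards [hSo.mem_nhds hy] with z hz using hGe z hz
  refine ⟨?_, ?_⟩
  · rw [isOpen_iff_mem_nhds]
    rintro _ ⟨p, hp, rfl⟩
    obtain ⟨S, hSo, hpS, hSsub, -⟩ := key p hp
    exact mem_of_superset (hSo.mem_nhds hpS) hSsub
  · rintro _ ⟨p, hp, rfl⟩
    obtain ⟨S, hSo, hpS, -, hGS⟩ := key p hp
    exact (hGS.contDiffAt (hSo.mem_nhds hpS)).contDiffWithinAt

end InverseSmooth

/-! ### `2π`-equivariant maps -/

section Equivariant

/-- Iterating `g (θ + 2π) = g θ + 2π`: `g (θ + 2πk) = g θ + 2πk` for all integers `k`. [folklore] -/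
theorem apply_add_int_mul_two_pi {g : ℝ → ℝ} (hg : ∀ θ, g (θ + 2 * Real.pi) = g θ + 2 * Real.pi)
    (k : ℤ) (θ : ℝ) : g (θ + k * (2 * Real.pi)) = g θ + k * (2 * Real.pi) := by
  have hnat : ∀ (m : ℕ) (θ : ℝ), g (θ + m * (2 * Real.pi)) = g θ + m * (2 * Real.pi) := by
    intro m
    induction m with
    | zero => intro θ; simp
    | succ m ih =>
        intro θ
        rw [Nat.cast_succ, add_mul, one_mul, ← add_assoc, hg, ih]
        ring
  have hneg : ∀ θ, g (θ - 2 * Real.pi) = g θ - 2 * Real.pi := fun θ => by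
    have := hg (θ - 2 * Real.pi)
    rw [sub_add_cancel] at this
    linarith
  have hnat' : ∀ (m : ℕ) (θ : ℝ), g (θ - m * (2 * Real.pi)) = g θ - m * (2 * Real.pi) := by
    intro m
    induction m with
    | zero => intro θ; simp
    | succ m ih =>
        intro θ
        rw [Nat.cast_succ, add_mul, one_mul, ← sub_sub, hneg, ih]
        ring
  obtain ⟨m, rfl | rfl⟩ := Int.eq_nat_or_neg k
  · exact_mod_cast hnat m θ
  · have := hnat' m θ
    simp only [Int.cast_neg, Int.cast_natCast, neg_mul, ← sub_eq_add_neg]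
    exact this

/-- Real exponents with the same point on the unit circle differ by an integer multiple of `2π`.
[folklore] -/
theorem exists_int_of_exp_mul_I_eq {a b : ℝ}
    (h : Complex.exp ((a : ℂ) * Complex.I) = Complex.exp ((b : ℂ) * Complex.I)) :
    ∃ k : ℤ, a = b + k * (2 * Real.pi) := by
  rw [Complex.exp_eq_exp_iff_exists_int] at h
  obtain ⟨k, hk⟩ := h
  refine ⟨k, ?_⟩
  have := congrArg Complex.im hk
  simpa [Complex.mul_im, Complex.add_im, Complex.mul_re] using this

/-- Conversely, exponents differing by `2πk` give the same point. [folklore] -/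
theorem exp_mul_I_eq_of_eq_add_int_mul {a b : ℝ} (k : ℤ) (h : a = b + k * (2 * Real.pi)) :
    Complex.exp ((a : ℂ) * Complex.I) = Complex.exp ((b : ℂ) * Complex.I) := by
  rw [Complex.exp_eq_exp_iff_exists_int]
  refine ⟨k, ?_⟩
  rw [h]
  push_cast
  ring

/-- For `2π`-equivariant `g`, the point `e^{i g θ}` of the circle only depends on `e^{iθ}`:
`exp (g (θ + 2πk) I) = exp (g θ I)`. [folklore] -/
theorem exp_mul_I_apply_add_int_mul {g : ℝ → ℝ} (hg : ∀ θ, g (θ + 2 * Real.pi) = g θ + 2 * Real.pi)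
    (k : ℤ) (θ : ℝ) :
    Complex.exp ((g (θ + k * (2 * Real.pi)) : ℂ) * Complex.I) = Complex.exp ((g θ : ℂ) * Complex.I) :=
  exp_mul_I_eq_of_eq_add_int_mul k (apply_add_int_mul_two_pi hg k θ)

/-- For `2π`-equivariant `g`, `e^{i g a} = e^{i g θ}` whenever `e^{ia} = e^{iθ}`. [folklore] -/
theorem exp_mul_I_apply_eq_of_exp_eq {g : ℝ → ℝ} (hg : ∀ θ, g (θ + 2 * Real.pi) = g θ + 2 * Real.pi)
    {a θ : ℝ} (h : Complex.exp ((a : ℂ) * Complex.I) = Complex.exp ((θ : ℂ) * Complex.I)) :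
    Complex.exp ((g a : ℂ) * Complex.I) = Complex.exp ((g θ : ℂ) * Complex.I) := by
  obtain ⟨k, rfl⟩ := exists_int_of_exp_mul_I_eq h
  exact exp_mul_I_apply_add_int_mul hg k θ

/-- An injective `2π`-equivariant map descends to an injective map of the circle: if
`exp (g θ₁ I) = exp (g θ₂ I)` then `exp (θ₁ I) = exp (θ₂ I)`. [folklore] -/
theorem exp_eq_exp_of_exp_apply_eq {g : ℝ → ℝ} (hg : ∀ θ, g (θ + 2 * Real.pi) = g θ + 2 * Real.pi)
    (hinj : Injective g) {θ₁ θ₂ : ℝ}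
    (h : Complex.exp ((g θ₁ : ℂ) * Complex.I) = Complex.exp ((g θ₂ : ℂ) * Complex.I)) :
    Complex.exp ((θ₁ : ℂ) * Complex.I) = Complex.exp ((θ₂ : ℂ) * Complex.I) := by
  obtain ⟨k, hk⟩ := exists_int_of_exp_mul_I_eq h
  rw [← apply_add_int_mul_two_pi hg k θ₂] at hk
  exact exp_mul_I_eq_of_eq_add_int_mul k (hinj hk)

end Equivariant

/-! ### The polar twist of a family of lifts -/

section Twist

open Complex

/-- `e^{i arg w} = w / ‖w‖` for `w ≠ 0`. [folklore] -/
theorem exp_arg_mul_I_eq {w : ℂ} (hw : w ≠ 0) : exp ((arg w : ℂ) * I) = (‖w‖ : ℂ)⁻¹ * w := by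
  have h := norm_mul_exp_arg_mul_I w
  have hn : (‖w‖ : ℂ) ≠ 0 := by exact_mod_cast norm_ne_zero_iff.2 hw
  calc exp ((arg w : ℂ) * I) = (‖w‖ : ℂ)⁻¹ * ((‖w‖ : ℂ) * exp ((arg w : ℂ) * I)) := by
        rw [← mul_assoc, inv_mul_cancel₀ hn, one_mul]
    _ = (‖w‖ : ℂ)⁻¹ * w := by rw [h]

/-- The other branch of the argument: `e^{i (arg (-w) + π)} = e^{i arg w}` for `w ≠ 0`. [folklore] -/
theorem exp_arg_neg_add_pi_mul_I {w : ℂ} (hw : w ≠ 0) :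
    exp (((arg (-w) + Real.pi : ℝ) : ℂ) * I) = exp ((arg w : ℂ) * I) := by
  rw [exp_arg_mul_I_eq hw]
  push_cast
  rw [add_mul, Complex.exp_add, exp_arg_mul_I_eq (neg_ne_zero.2 hw), Complex.exp_pi_mul_I, norm_neg]
  ring

/-- Two nonzero complex numbers with the same norm and the same direction are equal. [folklore] -/
theorem eq_of_norm_eq_of_exp_arg_eq {z₁ z₂ : ℂ} (hz₁ : z₁ ≠ 0) (hn : ‖z₁‖ = ‖z₂‖)
    (h : exp ((arg z₁ : ℂ) * I) = exp ((arg z₂ : ℂ) * I)) : z₁ = z₂ := by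
  have hz₂ : z₂ ≠ 0 := fun h0 => hz₁ (by rw [← norm_eq_zero, hn, h0, norm_zero])
  rw [exp_arg_mul_I_eq hz₁, exp_arg_mul_I_eq hz₂, hn] at h
  have hn' : (‖z₂‖ : ℂ) ≠ 0 := by exact_mod_cast norm_ne_zero_iff.2 hz₂
  exact mul_left_cancel₀ (inv_ne_zero hn') h

/-- **The polar twist** of a family of lifts `N : ℝ → ℝ → ℝ` (radius, angle):
`z = r e^{iθ} ↦ r e^{i N r θ}` (and `0 ↦ 0`). [folklore] -/
def twist (N : ℝ → ℝ → ℝ) (z : ℂ) : ℂ := (‖z‖ : ℂ) * exp ((N ‖z‖ (arg z) : ℂ) * I)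

/-- The twist preserves the norm. [folklore] -/
@[simp] theorem norm_twist (N : ℝ → ℝ → ℝ) (z : ℂ) : ‖twist N z‖ = ‖z‖ := by
  rw [twist, norm_mul, Complex.norm_real, Real.norm_eq_abs, abs_norm, Complex.norm_exp_ofReal_mul_I,
    mul_one]

/-- The twist fixes `0`. [folklore] -/
@[simp] theorem twist_zero (N : ℝ → ℝ → ℝ) : twist N 0 = 0 := by simp [twist]

/-- Where the lift is a rotation of the angle, the twist is the corresponding rotation of the
plane. [folklore] -/
theorem twist_eq_mul_of_eq_add {N : ℝ → ℝ → ℝ} {c : ℝ} {z : ℂ} (h : N ‖z‖ (arg z) = arg z + c) :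
    twist N z = exp ((c : ℂ) * I) * z := by
  rw [twist, h]
  push_cast
  rw [add_mul, Complex.exp_add]
  calc (‖z‖ : ℂ) * (exp ((arg z : ℂ) * I) * exp ((c : ℂ) * I))
      = exp ((c : ℂ) * I) * ((‖z‖ : ℂ) * exp ((arg z : ℂ) * I)) := by ring
    _ = exp ((c : ℂ) * I) * z := by rw [norm_mul_exp_arg_mul_I]

/-- The twist read through any local branch `α` of the argument (`e^{i α w} = e^{i arg w}`), by
`2π`-equivariance of the lifts. [folklore] -/
theorem twist_eq_of_exp_eq {N : ℝ → ℝ → ℝ} {w : ℂ} (hN : ∀ θ, N ‖w‖ (θ + 2 * Real.pi) = N ‖w‖ θ + 2 * Real.pi)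
    {a : ℝ} (ha : exp ((a : ℂ) * I) = exp ((arg w : ℂ) * I)) :
    twist N w = (‖w‖ : ℂ) * exp ((N ‖w‖ a : ℂ) * I) := by
  rw [twist, exp_mul_I_apply_eq_of_exp_eq hN ha]

/-- **Smoothness of the twist off the origin** (inside the unit disc), for lifts smooth jointly in
`(r, θ)` on `{r < 1} × ℝ` and `2π`-equivariant: near a point of the slit plane use the branch
`arg`, near the negative axis the branch `arg (-w) + π`. [folklore] -/
theorem contDiffAt_twist {N : ℝ → ℝ → ℝ} {n : WithTop ℕ∞}
    (hN : ContDiffOn ℝ n (fun p : ℝ × ℝ => N p.1 p.2) (Iio 1 ×ˢ univ))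
    (hNp : ∀ r < 1, ∀ θ, N r (θ + 2 * Real.pi) = N r θ + 2 * Real.pi) {z : ℂ} (hz : ‖z‖ < 1)
    (hz0 : z ≠ 0) : ContDiffAt ℝ n (twist N) z := by
  -- a smooth local branch `α` of the argument at `z`
  obtain ⟨α, hαc, hαeq⟩ : ∃ α : ℂ → ℝ, ContDiffAt ℝ n α z ∧
      ∀ᶠ w in 𝓝 z, exp ((α w : ℂ) * I) = exp ((arg w : ℂ) * I) := by
    by_cases hs : z ∈ slitPlane
    · refine ⟨arg, ?_, Eventually.of_forall fun w => rfl⟩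
      have h1 : ContDiffAt ℝ n Complex.log z := (Complex.contDiffAt_log hs).restrict_scalars ℝ
      have h2 : ContDiffAt ℝ n (fun w => (Complex.log w).im) z :=
        Complex.imCLM.contDiff.contDiffAt.comp z h1
      exact h2.congr_of_eventuallyEq (Eventually.of_forall fun w => (Complex.log_im w).symm)
    · -- `z` is a negative real: `-z ∈ slitPlane`
      have hneg : -z ∈ slitPlane := by
        rw [Complex.mem_slitPlane_iff, not_or, not_lt] at hs
        rw [Complex.mem_slitPlane_iff, Complex.neg_re, Complex.neg_im]
        have him : z.im = 0 := by
          by_contra h; exact hs.2 h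
        have hre : z.re < 0 := by
          rcases hs.1.lt_or_eq with h | h
          · exact h
          · exfalso; apply hz0; exact Complex.ext h him
        exact Or.inl (by linarith)
      refine ⟨fun w => arg (-w) + Real.pi, ?_, ?_⟩
      · have h1 : ContDiffAt ℝ n Complex.log (-z) := (Complex.contDiffAt_log hneg).restrict_scalars ℝ
        have h2 : ContDiffAt ℝ n (fun w => (Complex.log (-w)).im) z :=
          Complex.imCLM.contDiff.contDiffAt.comp z (h1.comp z contDiffAt_id.neg)
        exact (h2.congr_of_eventuallyEq
          (Eventually.of_forall fun w => (Complex.log_im (-w)).symm)).add contDiffAt_const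
      · filter_upwards [eventually_ne_nhds hz0] with w hw using exp_arg_neg_add_pi_mul_I hw
  -- the twist read through `α`, near `z`
  have hball : ∀ᶠ w in 𝓝 z, ‖w‖ < 1 := by
    have : IsOpen {w : ℂ | ‖w‖ < 1} := isOpen_lt continuous_norm continuous_const
    exact this.mem_nhds hz
  have heq : twist N =ᶠ[𝓝 z] fun w => (‖w‖ : ℂ) * exp ((N ‖w‖ (α w) : ℂ) * I) := by
    filter_upwards [hball, hαeq] with w hw hwα
    exact twist_eq_of_exp_eq (hNp _ hw) hwα
  refine ContDiffAt.congr_of_eventuallyEq ?_ heq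
  have hnorm : ContDiffAt ℝ n (fun w : ℂ => ‖w‖) z := contDiffAt_norm ℝ hz0
  have hNat : ContDiffAt ℝ n (fun p : ℝ × ℝ => N p.1 p.2) (‖z‖, α z) :=
    hN.contDiffAt ((isOpen_Iio.prod isOpen_univ).mem_nhds ⟨hz, mem_univ _⟩)
  have hcomp : ContDiffAt ℝ n (fun w : ℂ => N ‖w‖ (α w)) z :=
    (hNat.comp z (hnorm.prodMk hαc) : ContDiffAt ℝ n ((fun p : ℝ × ℝ => N p.1 p.2) ∘ fun w => (‖w‖, α w)) z)
  have hofReal : ContDiff ℝ n (fun x : ℝ => (x : ℂ)) := Complex.ofRealCLM.contDiff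
  have hexp : ContDiffAt ℝ n (fun w : ℂ => exp ((N ‖w‖ (α w) : ℂ) * I)) z :=
    Complex.contDiff_exp.contDiffAt.comp z (((hofReal.contDiffAt).comp z hcomp).mul contDiffAt_const)
  exact ((hofReal.contDiffAt).comp z hnorm).mul hexp

/-- Smoothness of the twist near the origin when the lifts are a fixed rotation for small radii.
[folklore] -/
theorem contDiffAt_twist_of_norm_lt_half {N : ℝ → ℝ → ℝ} {n : WithTop ℕ∞} {c : ℝ}
    (hNc : ∀ r ≤ 1 / 2, ∀ θ, N r θ = θ + c) {z : ℂ} (hz : ‖z‖ < 1 / 2) :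
    ContDiffAt ℝ n (twist N) z := by
  have heq : twist N =ᶠ[𝓝 z] fun w => exp ((c : ℂ) * I) * w := by
    have : IsOpen {w : ℂ | ‖w‖ < 1 / 2} := isOpen_lt continuous_norm continuous_const
    filter_upwards [this.mem_nhds hz] with w hw
    exact twist_eq_mul_of_eq_add (hNc _ (le_of_lt hw) _)
  exact (contDiffAt_const.mul contDiffAt_id).congr_of_eventuallyEq heq

/-- **The twist is smooth on the open unit disc** (lifts smooth on `{r < 1} × ℝ`,
`2π`-equivariant, and a fixed rotation for `r ≤ 1/2`). [folklore] -/
theorem contDiffOn_twist_ball {N : ℝ → ℝ → ℝ} {n : WithTop ℕ∞} {c : ℝ}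
    (hN : ContDiffOn ℝ n (fun p : ℝ × ℝ => N p.1 p.2) (Iio 1 ×ˢ univ))
    (hNp : ∀ r < 1, ∀ θ, N r (θ + 2 * Real.pi) = N r θ + 2 * Real.pi)
    (hNc : ∀ r ≤ 1 / 2, ∀ θ, N r θ = θ + c) : ContDiffOn ℝ n (twist N) (ball 0 1) := by
  intro z hz
  rw [mem_ball_zero_iff] at hz
  by_cases h : ‖z‖ < 1 / 2
  · exact (contDiffAt_twist_of_norm_lt_half hNc h).contDiffWithinAt
  · have hz0 : z ≠ 0 := fun h0 => h (by rw [h0, norm_zero]; norm_num)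
    exact (contDiffAt_twist hN hNp hz hz0).contDiffWithinAt

/-- The twist maps the open unit disc into itself. [folklore] -/
theorem mapsTo_twist_ball (N : ℝ → ℝ → ℝ) : MapsTo (twist N) (ball 0 1) (ball 0 1) := fun z hz => by
  rwa [mem_ball_zero_iff, norm_twist, ← mem_ball_zero_iff]

/-- **The twist is injective** on the open unit disc when the lifts are injective and
`2π`-equivariant. [folklore] -/
theorem injOn_twist_ball {N : ℝ → ℝ → ℝ} (hNp : ∀ r < 1, ∀ θ, N r (θ + 2 * Real.pi) = N r θ + 2 * Real.pi)
    (hNi : ∀ r < 1, Injective (N r)) : InjOn (twist N) (ball 0 1) := by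
  intro z₁ hz₁ z₂ hz₂ h
  rw [mem_ball_zero_iff] at hz₁ hz₂
  have hn : ‖z₁‖ = ‖z₂‖ := by rw [← norm_twist N z₁, h, norm_twist]
  by_cases h0 : z₁ = 0
  · subst h0
    rw [norm_zero] at hn
    exact (norm_eq_zero.1 hn.symm).symm
  · have hr : (‖z₁‖ : ℂ) ≠ 0 := by exact_mod_cast norm_ne_zero_iff.2 h0
    rw [twist, twist, ← hn] at h
    have h' := mul_left_cancel₀ hr h
    exact eq_of_norm_eq_of_exp_arg_eq h0 hn (exp_eq_exp_of_exp_apply_eq (hNp _ hz₁) (hNi _ hz₁) h')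

/-- **The twist is onto** the open unit disc when the lifts are onto and `2π`-equivariant.
[folklore] -/
theorem surjOn_twist_ball {N : ℝ → ℝ → ℝ} (hNp : ∀ r < 1, ∀ θ, N r (θ + 2 * Real.pi) = N r θ + 2 * Real.pi)
    (hNs : ∀ r < 1, Surjective (N r)) : SurjOn (twist N) (ball 0 1) (ball 0 1) := by
  intro w hw
  rw [mem_ball_zero_iff] at hw
  by_cases h0 : w = 0
  · exact ⟨0, mem_ball_self one_pos, by rw [twist_zero, h0]⟩
  · obtain ⟨θ, hθ⟩ := hNs _ hw (arg w)
    set z : ℂ := (‖w‖ : ℂ) * exp ((θ : ℂ) * I) with hz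
    have hnz : ‖z‖ = ‖w‖ := by
      rw [hz, norm_mul, Complex.norm_real, Real.norm_eq_abs, abs_norm, Complex.norm_exp_ofReal_mul_I,
        mul_one]
    have hz0 : z ≠ 0 := by rw [← norm_ne_zero_iff, hnz]; exact norm_ne_zero_iff.2 h0
    refine ⟨z, by rw [mem_ball_zero_iff, hnz]; exact hw, ?_⟩
    -- the direction of `z` is `e^{iθ}`
    have hdir : exp ((θ : ℂ) * I) = exp ((arg z : ℂ) * I) := by
      rw [exp_arg_mul_I_eq hz0, hnz, hz, ← mul_assoc,
        inv_mul_cancel₀ (show (‖w‖ : ℂ) ≠ 0 by exact_mod_cast norm_ne_zero_iff.2 h0), one_mul]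
    rw [twist_eq_of_exp_eq (by rw [hnz]; exact hNp _ hw) hdir, hnz, hθ, norm_mul_exp_arg_mul_I]

/-- The twist is a bijection of the open unit disc (lifts bijective and `2π`-equivariant).
[folklore] -/
theorem bijOn_twist_ball {N : ℝ → ℝ → ℝ} (hNp : ∀ r < 1, ∀ θ, N r (θ + 2 * Real.pi) = N r θ + 2 * Real.pi)
    (hNi : ∀ r < 1, Injective (N r)) (hNs : ∀ r < 1, Surjective (N r)) :
    BijOn (twist N) (ball 0 1) (ball 0 1) :=
  ⟨mapsTo_twist_ball N, injOn_twist_ball hNp hNi, surjOn_twist_ball hNp hNs⟩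

/-- Composition of twists: `twist N₁ (twist N₂ w) = ‖w‖ e^{i N₁ (N₂ (arg w))}` (inside the disc,
`N₁` equivariant). [folklore] -/
theorem twist_twist {N₁ N₂ : ℝ → ℝ → ℝ} {w : ℂ} (hw : ‖w‖ < 1)
    (hN₁ : ∀ r < 1, ∀ θ, N₁ r (θ + 2 * Real.pi) = N₁ r θ + 2 * Real.pi) :
    twist N₁ (twist N₂ w) = (‖w‖ : ℂ) * exp ((N₁ ‖w‖ (N₂ ‖w‖ (arg w)) : ℂ) * I) := by
  by_cases h0 : w = 0
  · subst h0; simp [twist]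
  · have hn : ‖twist N₂ w‖ = ‖w‖ := norm_twist N₂ w
    have hz0 : twist N₂ w ≠ 0 := by rw [← norm_ne_zero_iff, hn]; exact norm_ne_zero_iff.2 h0
    have hdir : exp ((N₂ ‖w‖ (arg w) : ℂ) * I) = exp ((arg (twist N₂ w) : ℂ) * I) := by
      rw [exp_arg_mul_I_eq hz0, hn, twist, ← mul_assoc,
        inv_mul_cancel₀ (show (‖w‖ : ℂ) ≠ 0 by exact_mod_cast norm_ne_zero_iff.2 h0), one_mul]
    rw [twist_eq_of_exp_eq (by rw [hn]; exact hN₁ _ hw) hdir, hn]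

end Twist

/-! ### The shear `(t, θ) ↦ (t, Λₜ θ)` and the inverse family of lifts -/

section InverseFamily

open LiftSmoothing

variable {φ : ℝ → ℝ}

/-- Positivity of `∂_θ Λₜ` for every `t < 1` (for `t < 0` the lift is a rotation). [folklore] -/
theorem deriv_family_pos' (hφ : Continuous φ) (hφm : Monotone φ) {t : ℝ} (ht : t < 1)
    (θ : ℝ) : 0 < deriv (family φ t) θ := by
  by_cases h : 0 ≤ t
  · exact deriv_family_pos hφ hφm h ht θ
  · have : family φ t = fun θ => θ + φ 0 := funext (family_of_le_half (by linarith))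
    rw [this, deriv_add_const, deriv_id'']
    exact one_pos

/-- `Λₜ` is strictly increasing for every `t < 1`. [folklore] -/
theorem strictMono_family' (hφ : Continuous φ) (hφm : Monotone φ) {t : ℝ} (ht : t < 1) :
    StrictMono (family φ t) :=
  strictMono_of_deriv_pos fun θ => deriv_family_pos' hφ hφm ht θ

variable (φ)

/-- The shear `T (t, θ) = (t, Λₜ θ)` of the half-plane `{t < 1} × ℝ`. [folklore] -/
def shear (p : ℝ × ℝ) : ℝ × ℝ := (p.1, family φ p.1 p.2)

variable {φ}

/-- The shear is smooth on `{t < 1} × ℝ`. [folklore] -/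
theorem contDiffOn_shear (hφ : Continuous φ) {n : ℕ∞} :
    ContDiffOn ℝ n (shear φ) (Iio 1 ×ˢ univ) :=
  contDiffOn_fst.prodMk (contDiffOn_family hφ)

/-- The shear is injective on `{t < 1} × ℝ`. [folklore] -/
theorem injOn_shear (hφ : Continuous φ) (hφm : Monotone φ) : InjOn (shear φ) (Iio 1 ×ˢ univ) := by
  rintro ⟨t, θ⟩ ⟨ht, -⟩ ⟨t', θ'⟩ ⟨-, -⟩ h
  simp only [shear, Prod.mk.injEq] at h
  obtain ⟨rfl, h2⟩ := h
  exact Prod.ext rfl ((strictMono_family' hφ hφm ht).injective h2)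

/-- The shear maps `{t < 1} × ℝ` onto itself. [folklore] -/
theorem image_shear (hφ : Continuous φ) (hφp : ∀ θ, φ (θ + 2 * Real.pi) = φ θ + 2 * Real.pi) :
    shear φ '' (Iio 1 ×ˢ univ) = Iio 1 ×ˢ univ := by
  refine Subset.antisymm ?_ ?_
  · rintro _ ⟨⟨t, θ⟩, ⟨ht, -⟩, rfl⟩
    exact ⟨ht, mem_univ _⟩
  · rintro ⟨t, η⟩ ⟨ht, -⟩
    obtain ⟨θ, hθ⟩ := surjective_family hφ hφp ht η
    exact ⟨(t, θ), ⟨ht, mem_univ _⟩, by simp [shear, hθ]⟩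

/-- The `θ`-partial derivative of `(t, θ) ↦ Λₜ θ` is `∂_θ Λₜ`. [folklore] -/
theorem fderiv_family_apply_zero_one (hφ : Continuous φ) {p : ℝ × ℝ} (hp : p.1 < 1) :
    fderiv ℝ (fun q : ℝ × ℝ => family φ q.1 q.2) p (0, 1) = deriv (family φ p.1) p.2 := by
  have hG : ContDiffAt ℝ 1 (fun q : ℝ × ℝ => family φ q.1 q.2) p :=
    (contDiffOn_family hφ (n := 1)).contDiffAt ((isOpen_Iio.prod isOpen_univ).mem_nhds ⟨hp, mem_univ _⟩)
  have hGd : HasFDerivAt (fun q : ℝ × ℝ => family φ q.1 q.2)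
      (fderiv ℝ (fun q : ℝ × ℝ => family φ q.1 q.2) p) p :=
    (hG.differentiableAt one_ne_zero).hasFDerivAt
  have hcurve : HasDerivAt (fun θ : ℝ => ((p.1, θ) : ℝ × ℝ)) ((0 : ℝ), (1 : ℝ)) p.2 :=
    (hasDerivAt_const p.2 p.1).prodMk (hasDerivAt_id p.2)
  have hcomp := hGd.comp_hasDerivAt p.2 hcurve
  have hcomp' : HasDerivAt (family φ p.1) (fderiv ℝ (fun q : ℝ × ℝ => family φ q.1 q.2) p (0, 1)) p.2 :=
    hcomp
  rw [hcomp'.deriv]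

/-- **The derivative of the shear is invertible** at every point of `{t < 1} × ℝ` (it is
triangular with diagonal `1`, `∂_θ Λₜ > 0`). [folklore] -/
theorem exists_equiv_hasStrictFDerivAt_shear (hφ : Continuous φ) (hφm : Monotone φ) {p : ℝ × ℝ}
    (hp : p ∈ Iio (1 : ℝ) ×ˢ (univ : Set ℝ)) :
    ∃ L : (ℝ × ℝ) ≃L[ℝ] (ℝ × ℝ), HasStrictFDerivAt (shear φ) (L : ℝ × ℝ →L[ℝ] ℝ × ℝ) p := by
  have hopen : Iio (1 : ℝ) ×ˢ (univ : Set ℝ) ∈ 𝓝 p := (isOpen_Iio.prod isOpen_univ).mem_nhds hp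
  have hT : ContDiffAt ℝ ∞ (shear φ) p := (contDiffOn_shear hφ (n := ⊤)).contDiffAt hopen
  have hstrict : HasStrictFDerivAt (shear φ) (fderiv ℝ (shear φ) p) p := hT.hasStrictFDerivAt (by simp)
  set D := fderiv ℝ (shear φ) p with hD
  -- the derivative is `v ↦ (v.1, fderiv G p v)`
  have hG : ContDiffAt ℝ ∞ (fun q : ℝ × ℝ => family φ q.1 q.2) p :=
    (contDiffOn_family hφ (n := ⊤)).contDiffAt hopen
  have hGd : DifferentiableAt ℝ (fun q : ℝ × ℝ => family φ q.1 q.2) p := hG.differentiableAt (by simp)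
  have hDeq : D = (ContinuousLinearMap.fst ℝ ℝ ℝ).prod (fderiv ℝ (fun q : ℝ × ℝ => family φ q.1 q.2) p) := by
    rw [hD, show shear φ = fun q : ℝ × ℝ => (q.1, family φ q.1 q.2) from rfl,
      DifferentiableAt.fderiv_prodMk differentiableAt_fst hGd, fderiv_fst]
  have hinj : Injective D := by
    intro v w hvw
    have h := congrArg (fun x => x - D w) hvw
    simp only [sub_self, ← map_sub] at h
    -- `D (v - w) = 0`
    set u := v - w with hu
    have h1 : u.1 = 0 := by
      have := congrArg Prod.fst h
      rw [hDeq] at this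
      simpa using this
    have h2 : fderiv ℝ (fun q : ℝ × ℝ => family φ q.1 q.2) p u = 0 := by
      have := congrArg Prod.snd h
      rw [hDeq] at this
      simpa using this
    have hu' : u = u.2 • ((0 : ℝ), (1 : ℝ)) := by
      ext <;> simp [h1]
    rw [hu', map_smul, fderiv_family_apply_zero_one hφ hp.1, smul_eq_mul] at h2
    have hpos := deriv_family_pos' hφ hφm hp.1 p.2
    have h3 : u.2 = 0 := by
      rcases mul_eq_zero.1 h2 with h | h
      · exact h
      · exact absurd h hpos.ne'
    have : u = 0 := by rw [hu', h3, zero_smul]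
    exact sub_eq_zero.1 this
  have hsurj : Surjective D := LinearMap.injective_iff_surjective.1 hinj
  refine ⟨ContinuousLinearEquiv.ofBijective D (LinearMap.ker_eq_bot.2 hinj) (LinearMap.range_eq_top.2 hsurj), ?_⟩
  rwa [ContinuousLinearEquiv.coe_ofBijective]

/-- **The inverse shear is smooth**: the image of `{t < 1} × ℝ` is itself and `invFunOn` of the
shear is `C^∞` there. [folklore] -/
theorem contDiffOn_invFunOn_shear (hφ : Continuous φ) (hφm : Monotone φ)
    (hφp : ∀ θ, φ (θ + 2 * Real.pi) = φ θ + 2 * Real.pi) {n : ℕ∞} :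
    ContDiffOn ℝ n (invFunOn (shear φ) (Iio 1 ×ˢ univ)) (Iio 1 ×ˢ univ) := by
  choose L hL using fun p (hp : p ∈ Iio (1 : ℝ) ×ˢ (univ : Set ℝ)) =>
    exists_equiv_hasStrictFDerivAt_shear hφ hφm hp
  have h := isOpen_image_and_contDiffOn_invFunOn (isOpen_Iio.prod isOpen_univ) (injOn_shear hφ hφm)
    (n := n) (L := fun p => if hp : p ∈ Iio (1 : ℝ) ×ˢ (univ : Set ℝ) then L p hp else ContinuousLinearEquiv.refl ℝ _)
    (fun p hp => by simp only [dif_pos hp]; exact hL p hp)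
    (fun p hp => ((contDiffOn_shear hφ (n := ⊤)).contDiffAt
      ((isOpen_Iio.prod isOpen_univ).mem_nhds hp)).of_le (by exact_mod_cast le_top))
  rw [image_shear hφ hφp] at h
  exact h.2

variable (φ)

/-- **The inverse family of lifts** `Mₜ = Λₜ⁻¹` (second component of the inverse shear). [folklore] -/
def invFamily (t η : ℝ) : ℝ := (invFunOn (shear φ) (Iio 1 ×ˢ univ) (t, η)).2

variable {φ}

/-- `Λₜ (Mₜ η) = η` for `t < 1`. [folklore] -/
theorem family_invFamily (hφ : Continuous φ) (hφp : ∀ θ, φ (θ + 2 * Real.pi) = φ θ + 2 * Real.pi)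
    {t : ℝ} (ht : t < 1) (η : ℝ) : family φ t (invFamily φ t η) = η := by
  have hmem : (t, η) ∈ shear φ '' (Iio 1 ×ˢ univ) := by
    rw [image_shear hφ hφp]; exact ⟨ht, mem_univ _⟩
  have h := invFunOn_eq (f := shear φ) (s := Iio 1 ×ˢ univ) (b := (t, η)) hmem
  -- `shear φ (invFunOn …) = (t, η)`
  have h1 : (invFunOn (shear φ) (Iio 1 ×ˢ univ) (t, η)).1 = t := by
    have := congrArg Prod.fst h
    simpa [shear] using this
  have h2 := congrArg Prod.snd h
  simp only [shear] at h2
  rw [h1] at h2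
  exact h2

/-- `Mₜ (Λₜ θ) = θ` for `t < 1`. [folklore] -/
theorem invFamily_family (hφ : Continuous φ) (hφm : Monotone φ) {t : ℝ} (ht : t < 1) (θ : ℝ) :
    invFamily φ t (family φ t θ) = θ := by
  have h := (injOn_shear hφ hφm).leftInvOn_invFunOn (f := shear φ) (⟨ht, mem_univ θ⟩ : (t, θ) ∈ Iio (1:ℝ) ×ˢ univ)
  have := congrArg Prod.snd h
  simpa [shear, invFamily] using this

/-- `Mₜ` is a two-sided inverse of `Λₜ`; in particular injective and surjective (`t < 1`). [folklore] -/
theorem injective_invFamily (hφ : Continuous φ) (hφp : ∀ θ, φ (θ + 2 * Real.pi) = φ θ + 2 * Real.pi)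
    {t : ℝ} (ht : t < 1) : Injective (invFamily φ t) := fun η₁ η₂ h => by
  rw [← family_invFamily hφ hφp ht η₁, h, family_invFamily hφ hφp ht η₂]

/-- See `injective_invFamily`. [folklore] -/
theorem surjective_invFamily (hφ : Continuous φ) (hφm : Monotone φ) {t : ℝ} (ht : t < 1) :
    Surjective (invFamily φ t) := fun θ => ⟨family φ t θ, invFamily_family hφ hφm ht θ⟩

/-- **Equivariance of the inverse lifts.** [folklore] -/
theorem invFamily_add_two_pi (hφ : Continuous φ) (hφm : Monotone φ)
    (hφp : ∀ θ, φ (θ + 2 * Real.pi) = φ θ + 2 * Real.pi) {t : ℝ} (ht : t < 1) (η : ℝ) :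
    invFamily φ t (η + 2 * Real.pi) = invFamily φ t η + 2 * Real.pi := by
  apply (strictMono_family' hφ hφm ht).injective
  rw [family_invFamily hφ hφp ht, family_add_two_pi hφ hφp ht, family_invFamily hφ hφp ht]

/-- For `t ≤ 1/2` the inverse lift is the inverse rotation `η ↦ η - φ 0`. [folklore] -/
theorem invFamily_of_le_half (hφ : Continuous φ) (hφm : Monotone φ)
    (hφp : ∀ θ, φ (θ + 2 * Real.pi) = φ θ + 2 * Real.pi) {t : ℝ} (ht : t ≤ 1 / 2) (η : ℝ) :
    invFamily φ t η = η - φ 0 := by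
  have ht1 : t < 1 := by linarith
  apply (strictMono_family' hφ hφm ht1).injective
  rw [family_invFamily hφ hφp ht1, family_of_le_half ht]
  ring

/-- **Joint smoothness of the inverse lifts** on `{t < 1} × ℝ`. [folklore] -/
theorem contDiffOn_invFamily (hφ : Continuous φ) (hφm : Monotone φ)
    (hφp : ∀ θ, φ (θ + 2 * Real.pi) = φ θ + 2 * Real.pi) {n : ℕ∞} :
    ContDiffOn ℝ n (fun q : ℝ × ℝ => invFamily φ q.1 q.2) (Iio 1 ×ˢ univ) := by
  have h := contDiffOn_snd.comp (contDiffOn_invFunOn_shear hφ hφm hφp (n := n)) (mapsTo_univ _ _)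
  exact h.congr fun q _ => by rfl

end InverseFamily

/-! ### Lifting a circle homeomorphism -/

section Lift

open Complex

/-- A continuous real function all of whose values are integers is constant. [folklore] -/
theorem apply_eq_apply_of_continuous_of_int_valued {q : ℝ → ℝ} (hq : Continuous q)
    (hk : ∀ θ, ∃ k : ℤ, q θ = k) (a b : ℝ) : q a = q b := by
  by_contra hne
  have key : ∀ {a b : ℝ}, q a < q b → False := by
    intro a b hlt
    obtain ⟨ka, hka⟩ := hk a
    obtain ⟨kb, hkb⟩ := hk b
    have hk1 : ka + 1 ≤ kb := by
      have : (ka : ℝ) < kb := by rw [← hka, ← hkb]; exact hlt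
      exact_mod_cast this
    have hmem : (ka : ℝ) + 1 / 2 ∈ uIcc (q a) (q b) := by
      rw [uIcc_of_le hlt.le, hka, hkb]
      have : (ka : ℝ) + 1 ≤ kb := by exact_mod_cast hk1
      constructor <;> linarith
    obtain ⟨c, -, hc⟩ := intermediate_value_uIcc hq.continuousOn hmem
    obtain ⟨kc, hkc⟩ := hk c
    rw [hkc] at hc
    have h2 : (2 : ℝ) * ((kc - ka : ℤ) : ℝ) = 1 := by push_cast; linarith
    have h3 : (2 * (kc - ka) : ℤ) = 1 := by exact_mod_cast h2
    omega
  rcases lt_or_gt_of_ne hne with h | h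
  · exact key h
  · exact key h

/-- If equal values of a continuous `φ : ℝ → ℝ` can only occur at points with the same image on
the circle (`φ a = φ b → e^{ia} = e^{ib}`), then `φ` is injective: an interior extremum on a
segment with equal end values would produce two points at distance `< 2π` with the same value.
[folklore] -/
theorem injective_of_apply_eq_imp_exp_eq {φ : ℝ → ℝ} (hφc : Continuous φ)
    (h : ∀ a b, φ a = φ b → exp ((a : ℂ) * I) = exp ((b : ℂ) * I)) : Injective φ := by
  -- two points at distance in `(0, 2π)` have different values
  have hnear : ∀ a b, a < b → b - a < 2 * Real.pi → φ a ≠ φ b := by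
    intro a b hab hlt heq
    obtain ⟨k, hk⟩ := exists_int_of_exp_mul_I_eq (h a b heq)
    have hπ : 0 < 2 * Real.pi := by positivity
    have hk1 : (-1 : ℝ) < k := by
      by_contra hc
      have hc' : (k : ℝ) ≤ -1 := not_lt.1 hc
      have : (k : ℝ) * (2 * Real.pi) ≤ -1 * (2 * Real.pi) := mul_le_mul_of_nonneg_right hc' hπ.le
      linarith
    have hk2 : (k : ℝ) < 0 := by
      by_contra hc
      have hc' : (0 : ℝ) ≤ k := not_lt.1 hc
      have : 0 ≤ (k : ℝ) * (2 * Real.pi) := mul_nonneg hc' hπ.le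
      linarith
    have hk3 : (-1 : ℤ) < k := by exact_mod_cast hk1
    have hk4 : k < 0 := by exact_mod_cast hk2
    omega
  intro a b hab
  by_contra hne
  wlog hlt : a < b generalizing a b
  · exact this hab.symm (Ne.symm hne) (lt_of_le_of_ne (not_lt.1 hlt) (Ne.symm hne))
  obtain ⟨c, hc, hext⟩ := exists_Ioo_extr_on_Icc hlt hφc.continuousOn hab
  obtain ⟨ε, hε, hεa, hεb, hε2⟩ : ∃ ε > 0, a ≤ c - ε ∧ c + ε ≤ b ∧ 2 * ε < 2 * Real.pi := by
    refine ⟨min (min (c - a) (b - c)) 1, ?_, ?_, ?_, ?_⟩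
    · exact lt_min (lt_min (by linarith [hc.1]) (by linarith [hc.2])) one_pos
    · linarith [min_le_left (min (c - a) (b - c)) 1, min_le_left (c - a) (b - c)]
    · linarith [min_le_left (min (c - a) (b - c)) 1, min_le_right (c - a) (b - c)]
    · linarith [min_le_right (min (c - a) (b - c)) 1, Real.pi_gt_three]
  have hl : c - ε ∈ Icc a b := ⟨hεa, by linarith [hc.2]⟩
  have hr : c + ε ∈ Icc a b := ⟨by linarith [hc.1], hεb⟩
  have hcont₁ : ContinuousOn φ (Icc (c - ε) c) := hφc.continuousOn
  have hcont₂ : ContinuousOn φ (Icc c (c + ε)) := hφc.continuousOn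
  rcases hext with hmin | hmax
  · have h1 : φ c ≤ φ (c - ε) := hmin hl
    have h2 : φ c ≤ φ (c + ε) := hmin hr
    rcases le_total (φ (c - ε)) (φ (c + ε)) with h3 | h3
    · obtain ⟨d, hd, hdv⟩ := intermediate_value_Icc (show c ≤ c + ε by linarith) hcont₂ ⟨h1, h3⟩
      exact hnear (c - ε) d (by linarith [hd.1]) (by linarith [hd.2]) hdv.symm
    · obtain ⟨d, hd, hdv⟩ := intermediate_value_Icc' (show c - ε ≤ c by linarith) hcont₁ ⟨h2, h3⟩
      exact hnear d (c + ε) (by linarith [hd.2]) (by linarith [hd.1]) hdv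
  · have h1 : φ (c - ε) ≤ φ c := hmax hl
    have h2 : φ (c + ε) ≤ φ c := hmax hr
    rcases le_total (φ (c - ε)) (φ (c + ε)) with h3 | h3
    · obtain ⟨d, hd, hdv⟩ := intermediate_value_Icc (show c - ε ≤ c by linarith) hcont₁ ⟨h3, h2⟩
      exact hnear d (c + ε) (by linarith [hd.2]) (by linarith [hd.1]) hdv
    · obtain ⟨d, hd, hdv⟩ := intermediate_value_Icc' (show c ≤ c + ε by linarith) hcont₂ ⟨h3, h1⟩
      exact hnear (c - ε) d (by linarith [hd.1]) (by linarith [hd.2]) hdv.symm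

/-- `e^{i(θ + 2π)} = e^{iθ}`. [folklore] -/
theorem exp_add_two_pi_mul_I (θ : ℝ) :
    exp ((((θ + 2 * Real.pi : ℝ)) : ℂ) * I) = exp (((θ : ℝ) : ℂ) * I) := by
  push_cast
  rw [add_mul, Complex.exp_add, Complex.exp_two_pi_mul_I, mul_one]

/-- **Lifting a circle homeomorphism.** A continuous bijection `f` of the unit circle onto itself
has a continuous lift `φ : ℝ → ℝ`, `f (e^{iθ}) = e^{i φ θ}`, which is either strictly increasing
with `φ (θ + 2π) = φ θ + 2π` or strictly decreasing with `φ (θ + 2π) = φ θ - 2π` (degree `±1`).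
(Continuous logarithm along `ℝ`; injectivity of `f` forbids interior extrema on a period and
degrees `|d| ≥ 2`.) [folklore] -/
theorem exists_lift_of_bijOn_sphere {f : ℂ → ℂ} (hfc : ContinuousOn f (sphere 0 1))
    (hf : BijOn f (sphere 0 1) (sphere 0 1)) :
    ∃ φ : ℝ → ℝ, Continuous φ ∧ (∀ θ : ℝ, f (exp ((θ : ℂ) * I)) = exp ((φ θ : ℂ) * I)) ∧
      ((StrictMono φ ∧ ∀ θ, φ (θ + 2 * Real.pi) = φ θ + 2 * Real.pi) ∨
        (StrictAnti φ ∧ ∀ θ, φ (θ + 2 * Real.pi) = φ θ - 2 * Real.pi)) := by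
  have hsph : ∀ θ : ℝ, exp ((θ : ℂ) * I) ∈ sphere (0 : ℂ) 1 := fun θ => by
    rw [mem_sphere_zero_iff_norm, Complex.norm_exp_ofReal_mul_I]
  set γ : ℝ → ℂ := fun θ => f (exp ((θ : ℂ) * I)) with hγ
  have hγc : Continuous γ :=
    hfc.comp_continuous (Complex.continuous_exp.comp (Complex.continuous_ofReal.mul continuous_const)) hsph
  have hγ1 : ∀ θ, ‖γ θ‖ = 1 := fun θ => mem_sphere_zero_iff_norm.1 (hf.mapsTo (hsph θ))
  have hγ0 : ∀ θ, γ θ ≠ 0 := fun θ h0 => by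
    have := hγ1 θ; rw [h0, norm_zero] at this; exact zero_ne_one this
  obtain ⟨L, hLc, hL⟩ := hasLogOn_univ isSimplyConnected_univ_real hγc hγ0
  set φ : ℝ → ℝ := fun θ => (L θ).im with hφ
  have hφc : Continuous φ := Complex.continuous_im.comp (continuousOn_univ.1 hLc)
  have hre : ∀ θ, (L θ).re = 0 := fun θ => by
    have h1 : ‖exp (L θ)‖ = 1 := by rw [hL θ (mem_univ _)]; exact hγ1 θ
    rw [Complex.norm_exp] at h1
    exact (Real.exp_eq_one_iff _).1 h1
  have hlift : ∀ θ, γ θ = exp ((φ θ : ℂ) * I) := fun θ => by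
    rw [← hL θ (mem_univ _)]
    congr 1
    apply Complex.ext <;> simp [hφ, hre θ]
  refine ⟨φ, hφc, hlift, ?_⟩
  -- periodicity of the loop and the degree
  have hper : ∀ θ, γ (θ + 2 * Real.pi) = γ θ := fun θ => by
    show f _ = f _
    rw [exp_add_two_pi_mul_I]
  have hk : ∀ θ, ∃ k : ℤ, φ (θ + 2 * Real.pi) = φ θ + k * (2 * Real.pi) := fun θ =>
    exists_int_of_exp_mul_I_eq (by rw [← hlift, ← hlift, hper])
  set q : ℝ → ℝ := fun θ => (φ (θ + 2 * Real.pi) - φ θ) / (2 * Real.pi) with hq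
  have hπ : 0 < 2 * Real.pi := by positivity
  have hqc : Continuous q := ((hφc.comp (continuous_id.add continuous_const)).sub hφc).div_const _
  have hqk : ∀ θ, ∃ k : ℤ, q θ = k := fun θ => by
    obtain ⟨k, hk⟩ := hk θ
    exact ⟨k, by rw [hq]; field_simp; linarith⟩
  obtain ⟨d, hd⟩ := hk 0
  rw [zero_add] at hd
  have hdeg : ∀ θ, φ (θ + 2 * Real.pi) = φ θ + d * (2 * Real.pi) := fun θ => by
    have h1 := apply_eq_apply_of_continuous_of_int_valued hqc hqk θ 0
    simp only [hq, zero_add] at h1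
    rw [hd, div_eq_div_iff hπ.ne' hπ.ne'] at h1
    nlinarith [h1, hπ]
  -- injectivity of the lift
  have hinj : Injective φ := by
    refine injective_of_apply_eq_imp_exp_eq hφc fun a b hab => ?_
    have : γ a = γ b := by rw [hlift, hlift, hab]
    exact hf.injOn (hsph a) (hsph b) this
  -- no point of `(0, 2π)` has the same image as `0`
  have hno : ∀ c ∈ Icc (0 : ℝ) (2 * Real.pi), exp ((φ c : ℂ) * I) = exp ((φ 0 : ℂ) * I) →
      c = 0 ∨ c = 2 * Real.pi := by
    intro c hc h
    have h1 : γ c = γ 0 := by rw [hlift, hlift, h]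
    have h2 := hf.injOn (hsph c) (hsph 0) h1
    obtain ⟨m, hm⟩ := exists_int_of_exp_mul_I_eq h2
    rw [zero_add] at hm
    have hm0 : (0 : ℝ) ≤ m * (2 * Real.pi) := by rw [← hm]; exact hc.1
    have hm1 : m * (2 * Real.pi) ≤ 1 * (2 * Real.pi) := by rw [← hm, one_mul]; exact hc.2
    have hm0' : (0 : ℝ) ≤ m := nonneg_of_mul_nonneg_left hm0 hπ
    have hm1' : (m : ℝ) ≤ 1 := le_of_mul_le_mul_right hm1 hπ
    have hm0'' : (0 : ℤ) ≤ m := by exact_mod_cast hm0'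
    have hm1'' : m ≤ 1 := by exact_mod_cast hm1'
    rcases (show m = 0 ∨ m = 1 by omega) with rfl | rfl
    · left; rw [hm]; simp
    · right; rw [hm]; simp
  rcases hφc.strictMono_of_inj hinj with hmono | hanti
  · left
    refine ⟨hmono, fun θ => ?_⟩
    -- `d = 1`
    have hd1 : (0 : ℝ) < d := by
      have := hmono hπ
      rw [show (2 * Real.pi) = 0 + 2 * Real.pi by ring, hdeg 0] at this
      nlinarith
    have hd2 : ¬ (2 : ℝ) ≤ d := fun h2 => by
      -- `φ 0 + 2π` lies strictly between `φ 0` and `φ (2π)`; attained at some `c ∈ (0, 2π)`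
      have hlt1 : φ 0 < φ 0 + 2 * Real.pi := by linarith
      have hlt2 : φ 0 + 2 * Real.pi < φ (0 + 2 * Real.pi) := by rw [hdeg 0]; nlinarith
      obtain ⟨c, hc, hcv⟩ := intermediate_value_Icc hπ.le hφc.continuousOn
        ⟨hlt1.le, by rw [zero_add] at hlt2; exact hlt2.le⟩
      have hexp : exp ((φ c : ℂ) * I) = exp ((φ 0 : ℂ) * I) :=
        exp_mul_I_eq_of_eq_add_int_mul 1 (by rw [hcv]; push_cast; ring)
      rcases hno c hc hexp with rfl | rfl
      · linarith
      · rw [show (2 * Real.pi) = 0 + 2 * Real.pi by ring, hdeg 0] at hcv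
        have : (d : ℝ) = 1 := by nlinarith
        linarith
    have hd3 : (0 : ℤ) < d := by exact_mod_cast hd1
    have hd4 : ¬ (2 : ℤ) ≤ d := fun h => hd2 (by exact_mod_cast h)
    have hd5 : d = 1 := by omega
    rw [hdeg θ, hd5]; simp
  · right
    refine ⟨hanti, fun θ => ?_⟩
    have hd1 : (d : ℝ) < 0 := by
      have := hanti hπ
      rw [show (2 * Real.pi) = 0 + 2 * Real.pi by ring, hdeg 0] at this
      nlinarith
    have hd2 : ¬ (d : ℝ) ≤ -2 := fun h2 => by
      have hlt1 : φ 0 - 2 * Real.pi < φ 0 := by linarith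
      have hlt2 : φ (0 + 2 * Real.pi) < φ 0 - 2 * Real.pi := by rw [hdeg 0]; nlinarith
      obtain ⟨c, hc, hcv⟩ := intermediate_value_Icc' hπ.le hφc.continuousOn
        ⟨by rw [zero_add] at hlt2; exact hlt2.le, hlt1.le⟩
      have hexp : exp ((φ c : ℂ) * I) = exp ((φ 0 : ℂ) * I) :=
        exp_mul_I_eq_of_eq_add_int_mul (-1) (by rw [hcv]; push_cast; ring)
      rcases hno c hc hexp with rfl | rfl
      · linarith
      · rw [show (2 * Real.pi) = 0 + 2 * Real.pi by ring, hdeg 0] at hcv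
        have : (d : ℝ) = -1 := by nlinarith
        linarith
    have hd3 : d < 0 := by exact_mod_cast hd1
    have hd4 : ¬ d ≤ -2 := fun h => hd2 (by exact_mod_cast h)
    have hd5 : d = -1 := by omega
    rw [hdeg θ, hd5]; simp; ring

end Lift

/-! ### The extension of a circle homeomorphism to the plane, smooth inside the disc -/

section Extension

open Complex LiftSmoothing ComplexConjugate

/-- `‖e^{ia} - e^{ib}‖ ≤ |a - b|`. [folklore] -/
theorem norm_exp_mul_I_sub_exp_mul_I_le (a b : ℝ) :
    ‖exp ((a : ℂ) * I) - exp ((b : ℂ) * I)‖ ≤ |a - b| := by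
  have h : exp ((a : ℂ) * I) - exp ((b : ℂ) * I) =
      exp ((b : ℂ) * I) * (exp (I * ((a - b : ℝ) : ℂ)) - 1) := by
    rw [mul_sub, mul_one, ← Complex.exp_add]
    congr 1
    push_cast
    ring
  rw [h, norm_mul, Complex.norm_exp_ofReal_mul_I, one_mul]
  exact (Real.norm_exp_I_mul_ofReal_sub_one_le (x := a - b)).trans (by rw [Real.norm_eq_abs])

/-- **Extension from a strictly increasing equivariant lift.** Let `f` be a continuous bijection
of the unit circle with lift `φ` (`f (e^{iθ}) = e^{iφ θ}`), `φ` continuous, strictly increasing and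
`2π`-equivariant. Then there is a homeomorphism `F` of `ℂ`, equal to `f` on the circle,
norm-preserving, which is a `C^∞` diffeomorphism of the open unit disc onto itself: inside the
disc `F` is the twist by the smoothed lifts `Λ_‖z‖` (`LiftSmoothing.family`), outside it is the
radial extension of `f`. [folklore] -/
theorem exists_extension_of_lift {f : ℂ → ℂ} {φ : ℝ → ℝ} (hfc : ContinuousOn f (sphere 0 1))
    (hf : BijOn f (sphere 0 1) (sphere 0 1)) (hφc : Continuous φ) (hφm : StrictMono φ)
    (hφp : ∀ θ, φ (θ + 2 * Real.pi) = φ θ + 2 * Real.pi)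
    (hfφ : ∀ θ : ℝ, f (exp ((θ : ℂ) * I)) = exp ((φ θ : ℂ) * I)) :
    ∃ F : ℂ ≃ₜ ℂ, EqOn F f (sphere 0 1) ∧ (∀ z, ‖F z‖ = ‖z‖) ∧
      ContDiffOn ℝ ∞ F (ball 0 1) ∧ ContDiffOn ℝ ∞ F.symm (ball 0 1) := by
  classical
  -- the two families of lifts
  set N : ℝ → ℝ → ℝ := family φ with hN
  set M : ℝ → ℝ → ℝ := invFamily φ with hM
  have hNp : ∀ r < 1, ∀ θ, N r (θ + 2 * Real.pi) = N r θ + 2 * Real.pi := fun r hr =>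
    family_add_two_pi hφc hφp hr
  have hNc : ∀ r ≤ 1 / 2, ∀ θ, N r θ = θ + φ 0 := fun r hr => family_of_le_half hr
  have hNsm : ContDiffOn ℝ ∞ (fun p : ℝ × ℝ => N p.1 p.2) (Iio 1 ×ˢ univ) := contDiffOn_family hφc
  have hNi : ∀ r < 1, Injective (N r) := fun r hr => (strictMono_family' hφc hφm.monotone hr).injective
  have hNs : ∀ r < 1, Surjective (N r) := fun r hr => surjective_family hφc hφp hr
  have hMp : ∀ r < 1, ∀ η, M r (η + 2 * Real.pi) = M r η + 2 * Real.pi := fun r hr =>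
    invFamily_add_two_pi hφc hφm.monotone hφp hr
  have hMc : ∀ r ≤ 1 / 2, ∀ η, M r η = η + -φ 0 := fun r hr η => by
    rw [hM, invFamily_of_le_half hφc hφm.monotone hφp hr]; ring
  have hMsm : ContDiffOn ℝ ∞ (fun p : ℝ × ℝ => M p.1 p.2) (Iio 1 ×ˢ univ) :=
    contDiffOn_invFamily hφc hφm.monotone hφp
  -- the inverse circle map and the radial extensions
  set g : ℂ → ℂ := invFunOn f (sphere 0 1) with hg
  have hginv : InvOn g f (sphere 0 1) (sphere 0 1) := hf.invOn_invFunOn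
  have hgm : MapsTo g (sphere 0 1) (sphere 0 1) := hf.surjOn.mapsTo_invFunOn
  set R : ℂ → ℂ := Schoenflies.radialExtend f with hR
  set R' : ℂ → ℂ := Schoenflies.radialExtend g with hR'
  have hRc : Continuous R := Schoenflies.continuous_radialExtend hfc hf.mapsTo
  have hRn : ∀ z, ‖R z‖ = ‖z‖ := Schoenflies.norm_radialExtend hf.mapsTo
  have hR'n : ∀ z, ‖R' z‖ = ‖z‖ := Schoenflies.norm_radialExtend hgm
  have hR'R : ∀ z, R' (R z) = z := Schoenflies.radialExtend_radialExtend hf.mapsTo hginv.1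
  have hRR' : ∀ z, R (R' z) = z := Schoenflies.radialExtend_radialExtend hgm hginv.2
  have hR1 : ∀ {z : ℂ}, ‖z‖ = 1 → R z = f z := fun hz => Schoenflies.radialExtend_of_norm_eq_one hz
  -- the glued map
  set Fin : ℂ → ℂ := fun z => if ‖z‖ < 1 then twist N z else R z with hFin
  have hFin_lt : ∀ {z : ℂ}, ‖z‖ < 1 → Fin z = twist N z := fun hz => if_pos hz
  have hFin_ge : ∀ {z : ℂ}, 1 ≤ ‖z‖ → Fin z = R z := fun hz => if_neg (not_lt.2 hz)
  have hnorm : ∀ z, ‖Fin z‖ = ‖z‖ := fun z => by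
    by_cases hz : ‖z‖ < 1
    · rw [hFin_lt hz, norm_twist]
    · rw [hFin_ge (not_lt.1 hz), hRn]
  have hsphere : ∀ {z : ℂ}, ‖z‖ = 1 → Fin z = f z := fun hz => by rw [hFin_ge hz.ge, hR1 hz]
  -- continuity
  have hsm : ContDiffOn ℝ ∞ (twist N) (ball 0 1) := contDiffOn_twist_ball hNsm hNp hNc
  have hcont : Continuous Fin := by
    rw [continuous_iff_continuousAt]
    intro z
    rcases lt_trichotomy ‖z‖ 1 with hz | hz | hz
    · have hev : Fin =ᶠ[𝓝 z] twist N := by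
        filter_upwards [(isOpen_lt continuous_norm continuous_const).mem_nhds hz] with w hw
        exact hFin_lt hw
      refine ContinuousAt.congr ?_ hev.symm
      exact hsm.continuousOn.continuousAt (isOpen_ball.mem_nhds (mem_ball_zero_iff.2 hz))
    · -- on the unit circle
      have hzs : z ∈ sphere (0 : ℂ) 1 := mem_sphere_zero_iff_norm.2 hz
      have hz0 : z ≠ 0 := by rw [← norm_ne_zero_iff, hz]; exact one_ne_zero
      rw [Metric.continuousAt_iff]
      intro ε hε
      -- (1) the outer map
      obtain ⟨δ₁, hδ₁, h₁⟩ := Metric.continuousAt_iff.1 hRc.continuousAt ε hε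
      -- (2) uniform closeness of the smoothed lifts
      obtain ⟨t₀, ht₀, h₂⟩ := family_sub_lt hφc hφm.monotone hφp (show (0 : ℝ) < ε / 3 by positivity)
      -- (3) continuity of `f` along directions
      have hdir : Tendsto (fun w : ℂ => (‖w‖ : ℂ)⁻¹ * w) (𝓝 z) (𝓝[sphere 0 1] z) := by
        have h0 : ContinuousAt (fun w : ℂ => (‖w‖ : ℂ)⁻¹ * w) z :=
          (((Complex.continuous_ofReal.comp continuous_norm).continuousAt).inv₀
            (by simpa using hz0)).mul continuousAt_id
        have hzdir : (‖z‖ : ℂ)⁻¹ * z = z := by rw [hz]; simp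
        refine tendsto_nhdsWithin_iff.2 ⟨by simpa [hzdir] using h0.tendsto, ?_⟩
        exact (eventually_ne_nhds hz0).mono fun w hw => Schoenflies.inv_norm_mul_mem_sphere hw
      have h₃' : Tendsto (fun w : ℂ => f ((‖w‖ : ℂ)⁻¹ * w)) (𝓝 z) (𝓝 (f z)) :=
        (hfc z hzs).tendsto.comp hdir
      obtain ⟨δ₃, hδ₃, h₃⟩ := Metric.tendsto_nhds_nhds.1 h₃' (ε / 3) (by positivity)
      refine ⟨min (min δ₁ (1 / 2)) (min (1 - t₀) (min (ε / 3) δ₃)), ?_, fun w hw => ?_⟩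
      · refine lt_min (lt_min hδ₁ (by norm_num)) (lt_min (by linarith) (lt_min (by positivity) hδ₃))
      have hw₁ : dist w z < δ₁ := lt_of_lt_of_le hw ((min_le_left _ _).trans (min_le_left _ _))
      have hw₂ : dist w z < 1 / 2 := lt_of_lt_of_le hw ((min_le_left _ _).trans (min_le_right _ _))
      have hw₃ : dist w z < 1 - t₀ := lt_of_lt_of_le hw ((min_le_right _ _).trans (min_le_left _ _))
      have hw₄ : dist w z < ε / 3 :=
        lt_of_lt_of_le hw ((min_le_right _ _).trans ((min_le_right _ _).trans (min_le_left _ _)))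
      have hw₅ : dist w z < δ₃ :=
        lt_of_lt_of_le hw ((min_le_right _ _).trans ((min_le_right _ _).trans (min_le_right _ _)))
      rw [hsphere hz]
      by_cases hwn : ‖w‖ < 1
      · -- inside: compare the twist with `f` at the direction of `w`
        have hwz : 1 - ‖w‖ ≤ dist w z := by
          have := norm_sub_norm_le z w
          rw [hz, ← dist_eq_norm, dist_comm] at this
          exact this
        have hw0 : w ≠ 0 := by
          intro h0
          rw [h0, dist_comm, dist_zero_right, hz] at hw₂
          linarith
        have hwt : ‖w‖ ∈ Ioo t₀ 1 := ⟨by linarith, hwn⟩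
        rw [hFin_lt hwn]
        set a := N ‖w‖ (arg w) with ha
        set b := φ (arg w) with hb
        have hfb : exp ((b : ℂ) * I) = f ((‖w‖ : ℂ)⁻¹ * w) := by
          rw [hb, ← hfφ, exp_arg_mul_I_eq hw0]
        have hsplit : twist N w - f z = ((‖w‖ : ℂ) - 1) * exp ((a : ℂ) * I) +
            ((exp ((a : ℂ) * I) - exp ((b : ℂ) * I)) + (f ((‖w‖ : ℂ)⁻¹ * w) - f z)) := by
          rw [← hfb, twist]; ring
        rw [dist_eq_norm, hsplit]
        have e1 : ‖((‖w‖ : ℂ) - 1) * exp ((a : ℂ) * I)‖ < ε / 3 := by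
          rw [norm_mul, Complex.norm_exp_ofReal_mul_I, mul_one,
            show ((‖w‖ : ℂ) - 1) = ((‖w‖ - 1 : ℝ) : ℂ) by push_cast; ring, Complex.norm_real,
            Real.norm_eq_abs, abs_sub_comm, abs_of_nonneg (by linarith)]
          linarith
        have e2 : ‖exp ((a : ℂ) * I) - exp ((b : ℂ) * I)‖ < ε / 3 :=
          (norm_exp_mul_I_sub_exp_mul_I_le a b).trans_lt (h₂ _ hwt _)
        have e3 : ‖f ((‖w‖ : ℂ)⁻¹ * w) - f z‖ < ε / 3 := by rw [← dist_eq_norm]; exact h₃ hw₅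
        calc _ ≤ ‖((‖w‖ : ℂ) - 1) * exp ((a : ℂ) * I)‖ +
              ‖(exp ((a : ℂ) * I) - exp ((b : ℂ) * I)) + (f ((‖w‖ : ℂ)⁻¹ * w) - f z)‖ := norm_add_le _ _
          _ ≤ ‖((‖w‖ : ℂ) - 1) * exp ((a : ℂ) * I)‖ +
              (‖exp ((a : ℂ) * I) - exp ((b : ℂ) * I)‖ + ‖f ((‖w‖ : ℂ)⁻¹ * w) - f z‖) := by
                gcongr; exact norm_add_le _ _
          _ < ε / 3 + (ε / 3 + ε / 3) := by gcongr
          _ = ε := by ring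
      · rw [hFin_ge (not_lt.1 hwn), ← hR1 hz]
        exact h₁ hw₁
    · have hev : Fin =ᶠ[𝓝 z] R := by
        filter_upwards [(isOpen_lt continuous_const continuous_norm).mem_nhds hz] with w hw
        exact hFin_ge (le_of_lt hw)
      exact hRc.continuousAt.congr hev.symm
  -- bijectivity
  have hinj : Injective Fin := by
    intro z₁ z₂ h
    have hn : ‖z₁‖ = ‖z₂‖ := by rw [← hnorm z₁, h, hnorm]
    by_cases hz : ‖z₁‖ < 1
    · rw [hFin_lt hz, hFin_lt (hn ▸ hz)] at h
      exact injOn_twist_ball hNp hNi (mem_ball_zero_iff.2 hz) (mem_ball_zero_iff.2 (hn ▸ hz)) h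
    · rw [hFin_ge (not_lt.1 hz), hFin_ge (hn ▸ not_lt.1 hz)] at h
      rw [← hR'R z₁, h, hR'R]
  have hsurj : Surjective Fin := by
    intro w
    by_cases hw : ‖w‖ < 1
    · obtain ⟨z, hz, hzw⟩ := surjOn_twist_ball hNp hNs (mem_ball_zero_iff.2 hw)
      exact ⟨z, by rw [hFin_lt (mem_ball_zero_iff.1 hz), hzw]⟩
    · refine ⟨R' w, ?_⟩
      rw [hFin_ge (by rw [hR'n]; exact not_lt.1 hw), hRR']
  have hproper : Tendsto Fin (cocompact ℂ) (cocompact ℂ) :=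
    Filter.tendsto_cocompact_cocompact_of_norm fun ε => ⟨ε, fun z hz => by rwa [hnorm]⟩
  have hHomeo : IsHomeomorph Fin :=
    isHomeomorph_iff_continuous_isClosedMap_bijective.2 ⟨hcont,
      (isProperMap_iff_tendsto_cocompact.2 ⟨hcont, hproper⟩).isClosedMap, hinj, hsurj⟩
  set F : ℂ ≃ₜ ℂ := IsHomeomorph.homeomorph Fin hHomeo with hF
  have hFap : ∀ z, F z = Fin z := fun z => rfl
  refine ⟨F, fun z hz => by rw [hFap, hsphere (mem_sphere_zero_iff_norm.1 hz)],
    fun z => by rw [hFap, hnorm], ?_, ?_⟩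
  · exact hsm.congr fun z hz => by rw [hFap, hFin_lt (mem_ball_zero_iff.1 hz)]
  · -- on the disc the inverse is the twist by the inverse lifts
    have hsm' : ContDiffOn ℝ ∞ (twist M) (ball 0 1) := contDiffOn_twist_ball hMsm hMp hMc
    refine hsm'.congr fun w hw => ?_
    have hw' : ‖w‖ < 1 := mem_ball_zero_iff.1 hw
    have hmem : twist M w ∈ ball (0 : ℂ) 1 := mapsTo_twist_ball M hw
    have hkey : F (twist M w) = w := by
      rw [hFap, hFin_lt (mem_ball_zero_iff.1 hmem), twist_twist hw' hNp]
      rw [hN, hM, family_invFamily hφc hφp hw', norm_mul_exp_arg_mul_I]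
    rw [← hkey, Homeomorph.symm_apply_apply, hkey]

/-- `conj (e^{iθ}) = e^{-iθ}`. [folklore] -/
theorem conj_exp_mul_I (θ : ℝ) : conj (exp ((θ : ℂ) * I)) = exp (((-θ : ℝ) : ℂ) * I) := by
  rw [← Complex.exp_conj, map_mul, Complex.conj_ofReal, Complex.conj_I]
  push_cast
  ring_nf

/-- **The Alexander trick with smooth interior.** Every homeomorphism of the unit circle — a
continuous bijection `f` of `sphere 0 1` onto itself — extends to a homeomorphism `F` of `ℂ`
onto itself which preserves the norm (so maps the closed unit disc onto itself and the circle
onto itself, where it is `f`) and restricts to a **`C^∞` diffeomorphism of the open unit disc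
onto itself**. (Lift `f` to `θ ↦ φ θ`; for a decreasing lift conjugate first; inside the disc
use the twist `r e^{iθ} ↦ r e^{i Λ_r θ}` by the smoothed lifts, a rotation near the centre and
converging to `f` at the boundary circle; outside use the radial extension.) Folklore
refinement of the cone construction (Bing (1983), proof of Thm. III.6.B; Pommerenke (1992),
proof of Cor. 2.9, formula (4)); published smooth-interior extensions are the harmonic one
(Radó–Kneser–Choquet) and the conformally natural one (Douady–Earle 1986). [folklore] -/
theorem exists_homeomorph_extension_contDiffOn {f : ℂ → ℂ} (hfc : ContinuousOn f (sphere 0 1))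
    (hf : BijOn f (sphere 0 1) (sphere 0 1)) :
    ∃ F : ℂ ≃ₜ ℂ, EqOn F f (sphere 0 1) ∧ (∀ z, ‖F z‖ = ‖z‖) ∧
      ContDiffOn ℝ ∞ F (ball 0 1) ∧ ContDiffOn ℝ ∞ F.symm (ball 0 1) := by
  obtain ⟨φ, hφc, hfφ, hcase⟩ := exists_lift_of_bijOn_sphere hfc hf
  rcases hcase with ⟨hmono, hφp⟩ | ⟨hanti, hφp⟩
  · exact exists_extension_of_lift hfc hf hφc hmono hφp hfφ
  · -- orientation-reversing: conjugate, extend, conjugate back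
    have hcs : MapsTo (conj : ℂ → ℂ) (sphere 0 1) (sphere 0 1) := fun z hz => by
      rw [mem_sphere_zero_iff_norm, Complex.norm_conj]; exact mem_sphere_zero_iff_norm.1 hz
    have hcbij : BijOn (conj : ℂ → ℂ) (sphere 0 1) (sphere 0 1) :=
      (show InvOn (conj : ℂ → ℂ) conj (sphere 0 1) (sphere 0 1) from
        ⟨fun z _ => Complex.conj_conj z, fun z _ => Complex.conj_conj z⟩).bijOn hcs hcs
    set f' : ℂ → ℂ := fun w => f (conj w) with hf'
    have hf'c : ContinuousOn f' (sphere 0 1) := hfc.comp Complex.continuous_conj.continuousOn hcs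
    have hf'bij : BijOn f' (sphere 0 1) (sphere 0 1) := hf.comp hcbij
    set φ' : ℝ → ℝ := fun θ => φ (-θ) with hφ'
    have hφ'c : Continuous φ' := hφc.comp continuous_neg
    have hφ'm : StrictMono φ' := fun a b hab => hanti (neg_lt_neg hab)
    have hφ'p : ∀ θ, φ' (θ + 2 * Real.pi) = φ' θ + 2 * Real.pi := fun θ => by
      simp only [hφ']
      have := hφp (-θ - 2 * Real.pi)
      rw [show -θ - 2 * Real.pi + 2 * Real.pi = -θ by ring] at this
      rw [show -(θ + 2 * Real.pi) = -θ - 2 * Real.pi by ring]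
      linarith
    have hf'φ' : ∀ θ : ℝ, f' (exp ((θ : ℂ) * I)) = exp ((φ' θ : ℂ) * I) := fun θ => by
      simp only [hf', hφ']
      rw [conj_exp_mul_I, hfφ]
    obtain ⟨F', hF'eq, hF'n, hF'sm, hF'sm'⟩ := exists_extension_of_lift hf'c hf'bij hφ'c hφ'm hφ'p hf'φ'
    -- complex conjugation as a homeomorphism (Mathlib's `Complex.conjCLE`)
    set cH : ℂ ≃ₜ ℂ := Complex.conjCLE.toHomeomorph with hcHdef
    have hcH : ∀ z, cH z = conj z := fun z => rfl
    have hcHs : ∀ z, cH.symm z = conj z := fun z => by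
      have h := cH.apply_symm_apply z
      rw [hcH] at h
      calc cH.symm z = conj (conj (cH.symm z)) := (Complex.conj_conj _).symm
        _ = conj z := by rw [h]
    refine ⟨cH.trans F', fun z hz => ?_, fun z => ?_, ?_, ?_⟩
    · rw [Homeomorph.trans_apply, hcH, hF'eq (hcs hz)]
      simp [hf']
    · rw [Homeomorph.trans_apply, hcH, hF'n, Complex.norm_conj]
    · have hcb : MapsTo (conj : ℂ → ℂ) (ball 0 1) (ball 0 1) := fun z hz => by
        rw [mem_ball_zero_iff, Complex.norm_conj]; exact mem_ball_zero_iff.1 hz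
      have h := hF'sm.comp Complex.conjCLE.contDiff.contDiffOn hcb
      exact h.congr fun z _ => by
        rw [Homeomorph.trans_apply, hcH, Function.comp_apply, Complex.conjCLE_apply]
    · have h := Complex.conjCLE.contDiff.comp_contDiffOn hF'sm'
      exact h.congr fun z _ => by
        rw [Homeomorph.symm_trans_apply, hcHs, Function.comp_apply, Complex.conjCLE_apply]

end Extension

end SmoothExtension

/-- **The Alexander trick with smooth interior** (restated at topic level, see
`SmoothExtension.exists_homeomorph_extension_contDiffOn`): every continuous bijection of the unit
circle onto itself extends to a norm-preserving homeomorphism of `ℂ` which is a `C^∞`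
diffeomorphism of the open unit disc onto itself. [folklore] -/
theorem exists_homeomorph_sphere_extension_contDiffOn_ball {f : ℂ → ℂ}
    (hfc : ContinuousOn f (sphere 0 1)) (hf : BijOn f (sphere 0 1) (sphere 0 1)) :
    ∃ F : ℂ ≃ₜ ℂ, EqOn F f (sphere 0 1) ∧ (∀ z, ‖F z‖ = ‖z‖) ∧
      ContDiffOn ℝ ∞ F (ball 0 1) ∧ ContDiffOn ℝ ∞ F.symm (ball 0 1) :=
  SmoothExtension.exists_homeomorph_extension_contDiffOn hfc hf

end Literature.Topology.PlaneTopology
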